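import Summits.ABC.ABC.Theorems.DefiniteXiDefiniteRTControlPrimeValTransport
import Summits.ABC.ABC.Theorems.KenkuLevelTwentySixRankZero
import Summits.ABC.ABC.Theorems.IsogenyGlueCongruenceMazurKenkuBoundLevelThirtyTwo
import Summits.ABC.ABC.Theorems.IsogenyGlueCongruenceKenkuCompositeTables
import Literature.NumberTheory.EllipticCurves.PastenHeightBoundsLemma68LocalProofs
import Literature.NumberTheory.EllipticCurves.MazurTorsionPrimeCaseFromCor44Proofs
import Literature.NumberTheory.EllipticCurves.KleinFrickeLevelTwentySeven
import Literature.NumberTheory.EllipticCurves.KleinFrickeLevelThirteen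
import Literature.NumberTheory.EllipticCurves.KleinFrickeLevelsTwoThree
import Literature.NumberTheory.EllipticCurves.KenkuLevelFortyNineProofs
import Literature.NumberTheory.EllipticCurves.FreyHellegouarchTwoIsogenousCurveProofs
import Literature.NumberTheory.EllipticCurves.OpenImageMazurInputs
import Literature.NumberTheory.DiophantineGeometry.DenesEquationLargeExponentsProofs
import Summits.ABC.ABC.Theses.DefiniteXi
import Summits.ABC.ABC.Theorems.DefiniteXiFreyModularity
import Summits.ABC.ABC.Theorems.DefiniteXiDefiniteRTControlPrimeSmulTransportDeg
import Summits.ABC.ABC.Theorems.DefiniteXiDefiniteRTControlPrimeFreyScale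
import Summits.ABC.ABC.Theorems.DefiniteXiDefiniteRTControlPrimeFreyLocal
import Literature.NumberTheory.EllipticCurves.TakahashiDegreeFormulaCoprimeProofs
import Literature.NumberTheory.EllipticCurves.PastenSpectralDegree
import Literature.NumberTheory.EllipticCurves.PastenHeightBounds
import Literature.NumberTheory.EllipticCurves.PastenSpectralDegreeIsogenyBoundProofs
import Literature.NumberTheory.EllipticCurves.ModularCurveManinSemistableBridgeProofs
import Literature.NumberTheory.EllipticCurves.ModularDegreeMinimal
import Literature.NumberTheory.EllipticCurves.IsogenyVariableChangeProofs
import Literature.NumberTheory.EllipticCurves.IsogenyCompProofs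
import Literature.NumberTheory.EllipticCurves.IsogenyDualProofs
import HarnessLib

/-!
# Stub ideas k2 (gen 3, family RESHAPE) — `stub_pastenLemma68 : PastenShimura2024_lemma_6_8`
(crux `DefiniteRTControlPrime`, stmt-ABC-11338, route `DefiniteXi`, skeleton `Lines/Sketch.lean`).

**Gen-3 reshape: NO kernel bookkeeping.**  The Frey-odd slice of Lemma 6.8 (the only instance the
skeleton consumes, via `stub_valTransport`, W = `freyCurve a b`, odd multiplicative `q`) follows from
the radius `≤ 163` of the Frey isogeny class.  The prime support `{2,3,7}` of that class is obtained
here WITHOUT constructing any `2m`/`4m`/`26`/`20`-kernels (k2-g2 D0/F1⁺/F4/F5, k3-g2 H5/H6/H7 — all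
eliminated):

* `5`:  **the tree already proves `E_(a,b)[5]` irreducible** —
  `Summit.ABC.ABC.Theorems.hasIrreducibleModPGaloisRep_freyCurve_five` (Diamond–Kramer + Kubert,
  `DefiniteXiFreyModularitySketchReshape3`, landed) and, independently,
  `hasIrreducibleModPGaloisRep_of_rational_two_torsion_of_degree_ne` (Darmon–Merel road, landed) +
  `Kenku1982.isogeny_isCyclic_degree_ne_twenty_holds` (landed).  Those modules are not yet built on
  the farm snapshot, so the input enters here as the displayed Prop `FreyFiveIrreducible` (= that
  theorem's statement, one token to discharge).  The only new piece is the generic bridge B5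
  `not_dvd_degree_of_hasIrreducibleModPGaloisRep` (PROVED below).
* `13`: **Klein–Fricke `2 × 13` on the Frey curve ITSELF** — `E_(a,b)` is in two-torsion normal
  form, so its explicit `2`-isogeny (`twoIsogeny`, degree `2`, cyclic) gives `j = (s+16)³/s`; a cyclic
  sub-degree `13` gives `j = f₁₃(t)` (cite-only `kleinFrickeThirteen_exists_j_eq`); the landed
  `fibreProduct_twentySix_empty` (D₂₆, unconditional) kills the pair.  No `26`-kernel.  (F13, PROVED.)
* `11, ≥ 17`: Mazur Cor. 4.4 at the odd multiplicative place (k3-g2 H1, re-proved here verbatim since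
  the k3 module is not importable).
* caps `27 ∤, 32 ∤, 49 ∤` (E27: `j(Frey) ≥ 0`; landed levels 32, 49) and `deg ≠ 21` (E21, NEW,
  PROVED: X₀(21) table `levelTwentyOne_jTable_of` + `j(Frey) ≥ 0` + `j(Frey) ≠ 3375/2` by a `2`-adic
  parity of `2⁹(a²+ab+b²)³ = 3375(ab(a+b))²`): the k3 covering certificate `{21,27,32,49}` then gives
  radius `≤ 163`.

**Sorry census of THIS file: NONE (rc 0, 0 sorries).**  Displayed hypotheses of the assemblies:
`h44 : Mazur1978.cor44_valuation_j_le_one` (Mazur 1978 Cor. 4.4; item MazurCor44, stmt-ABC-18223),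
`h13 : kleinFrickeThirteen_exists_j_eq` (Klein–Fricke level 13, cite-only), `h5 : FreyFiveIrreducible`
(the tree theorem above).  Net: `valTransport163 h44 h13 h5` has literally the type of the conclusion
of the landed `stub_valTransport h68` — the composition's `h68 : PastenShimura2024_lemma_6_8`
(Mazur-complete) is replaced by two printed, Mazur-Thm-1-free inputs + one tree theorem.
-/

set_option linter.dupNamespace false

noncomputable section

open scoped Classical
open WeierstrassCurve IsDedekindDomain NumberField
open Literature.NumberTheory.EllipticCurves Literature.NumberTheory.EllipticCurves.ModularForms
open Literature.NumberTheory.DiophantineGeometry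
open Summit.ABC.ABC.Theorems

namespace Summit.ABC.ABC.Cruxes.DefiniteRTControlPrime.StubIdeas2G3

/-! ## 0. Targets (texts identical to k2-g2 `FreyIsogenyRadius`, k3-g2 `Lemma68FreyOdd`) -/

/-- Radius of the Frey isogeny class at an odd conductor prime (k2-g2's `FreyIsogenyRadius`, same text). -/
def FreyIsogenyRadius (R : ℕ) : Prop :=
  ∀ (a b : ℤ), IsCoprime a b → a * b * (a + b) ≠ 0 → ∀ q : ℕ, q.Prime → q ≠ 2 →
    q ∣ (freyCurve a b).conductorNorm ℤ →
    ∀ (W' : WeierstrassCurve ℚ) [W'.IsElliptic], (freyCurve a b).IsIsogenous W' →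
      ∃ φ : Isogeny (freyCurve a b) W', φ.degree ≤ R

/-- Lemma 6.8 at a FREY source and an ODD multiplicative place (k3-g2's `Lemma68FreyOdd`, same text). -/
def Lemma68FreyOdd : Prop :=
  ∀ (a b : ℤ), IsCoprime a b → a * b * (a + b) ≠ 0 →
    ∀ (W' : WeierstrassCurve ℚ) [W'.IsElliptic], (freyCurve a b).IsIsogenous W' →
      ∀ v : HeightOneSpectrum ℤ, Rat.HeightOneSpectrum.natGenerator v ≠ 2 →
        (freyCurve a b).HasMultiplicativeReductionAt v →
          ∃ m n : ℕ, 0 < m ∧ m ≤ 163 ∧ 0 < n ∧ n ≤ 163 ∧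
            (freyCurve a b).ordMinimalDiscriminant v * n = W'.ordMinimalDiscriminant v * m

/-- **The tree's Frey rigidity at `5`, as a displayed Prop.**  Literally the statement of the landed
theorem `Summit.ABC.ABC.Theorems.hasIrreducibleModPGaloisRep_freyCurve_five`
(`DefiniteXiFreyModularitySketchReshape3.lean`; Diamond–Kramer 1995 Lemmas 1–3 + Kubert 1976
`X₁(2,10)`), equivalently of `hasIrreducibleModPGaloisRep_of_rational_two_torsion_of_degree_ne` at
`p = 5` fed with `Kenku1982.isogeny_isCyclic_degree_ne_twenty_holds`.  Discharge: one token, once the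
module is built on the farm. -/
def FreyFiveIrreducible : Prop :=
  ∀ (a b : ℤ), IsCoprime a b → (h0 : a * b * (a + b) ≠ 0) →
    haveI := isElliptic_freyCurve h0
    (freyCurve a b).HasIrreducibleModPGaloisRep 5

/-! ## 1. B5 (NEW, generic, PROVED): irreducible `E[p]` ⇒ no cyclic sub-degree `p` -/

/-- **B5.** If `E[p]` is an irreducible `Γ_ℚ`-module then `p` divides the degree of no cyclic
`ℚ`-isogeny out of `E` (the `p`-part of a cyclic kernel would be a stable line).  The body of the
tree's `mem_mazurPrimes_of_prime_dvd_degree` with Mazur's fact replaced by the hypothesis. -/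
theorem not_dvd_degree_of_hasIrreducibleModPGaloisRep {W W' : WeierstrassCurve ℚ} [W.IsElliptic]
    (φ : Isogeny W W') (hφ : φ.IsCyclic) {p : ℕ} (hp : p.Prime)
    (hirr : W.HasIrreducibleModPGaloisRep p) : ¬ p ∣ φ.degree := by
  intro hpd
  haveI : Fact p.Prime := ⟨hp⟩
  -- `H = E[p] ∩ ker φ`, a `Γ_ℚ`-stable subgroup of `E[p]`
  set H : AddSubgroup (geomTorsion W (p : ℤ)) :=
    (φ.toAddMonoidHom.comp (geomTorsion W (p : ℤ)).subtype).ker with hH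
  have hHmem : ∀ P : geomTorsion W (p : ℤ), P ∈ H ↔ φ (P : W.geomPoints) = 0 := fun P ↦ by
    rw [hH, AddMonoidHom.mem_ker]
    rfl
  have hstab : ∀ σ : Field.absoluteGaloisGroup ℚ, ∀ P ∈ H, σ • P ∈ H := fun σ P hP ↦ by
    rw [hHmem] at hP ⊢
    rw [AddSubgroup.torsionBy.coe_smul, φ.map_smul, hP, smul_zero]
  rcases hirr H hstab with hbot | htop
  · -- Cauchy: `ker φ` has an element of order `p`, a non-zero point of `E[p] ∩ ker φ`
    obtain ⟨Q, hQ⟩ := exists_prime_addOrderOf_dvd_card' (G := φ.toAddMonoidHom.ker) p hpd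
    have hQp : p • ((Q : φ.toAddMonoidHom.ker) : W.geomPoints) = 0 := by
      have h := congrArg Subtype.val (addOrderOf_nsmul_eq_zero Q)
      rwa [hQ, AddSubmonoidClass.coe_nsmul] at h
    have hQ0 : ((Q : φ.toAddMonoidHom.ker) : W.geomPoints) ≠ 0 := fun h0 ↦ by
      rw [show Q = 0 from Subtype.ext h0, addOrderOf_zero] at hQ
      exact hp.one_lt.ne hQ
    have hmemH : (⟨(Q : W.geomPoints), AddSubgroup.torsionBy.nsmul_iff.mpr hQp⟩ :
        geomTorsion W (p : ℤ)) ∈ H := (hHmem _).mpr ((AddMonoidHom.mem_ker).mp Q.2)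
    rw [hbot, AddSubgroup.mem_bot] at hmemH
    exact hQ0 (congrArg Subtype.val hmemH)
  · -- `E[p] ≤ ker φ` would make `E[p]` cyclic, but it has exponent `p` and order `p²`
    have hle : geomTorsion W (p : ℤ) ≤ φ.toAddMonoidHom.ker := fun P hP ↦
      (AddMonoidHom.mem_ker).mpr ((hHmem ⟨P, hP⟩).mp (htop ▸ AddSubgroup.mem_top _))
    haveI : IsAddCyclic φ.toAddMonoidHom.ker := hφ
    haveI : IsAddCyclic (geomTorsion W (p : ℤ)) := AddSubgroup.isAddCyclic_of_le hle
    have hdvd : AddMonoid.exponent (geomTorsion W (p : ℤ)) ∣ p :=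
      AddMonoid.exponent_dvd_of_forall_nsmul_eq_zero fun P ↦ AddSubgroup.torsionBy.nsmul P
    rw [IsAddCyclic.exponent_eq_card,
      natCard_geomTorsion_eq_sq W (Nat.cast_ne_zero.mpr hp.ne_zero)] at hdvd
    have h1 := Nat.le_of_dvd hp.pos hdvd
    have h2 := hp.two_le
    nlinarith

/-! ## 2. F5 (PROVED from B5 + the tree's Frey rigidity at 5): no cyclic sub-degree `5` out of a Frey curve -/

/-- **F5.** `5 ∤ deg ψ` for every cyclic `ℚ`-isogeny `ψ` out of `E_(a,b)` (`a, b` coprime,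
`ab(a+b) ≠ 0`). Replaces k2-g2 F5/D0/F1⁺ and k3-g2 H6/H7 + level 20. -/
theorem five_not_dvd_degree_freyCurve (h5 : FreyFiveIrreducible) {a b : ℤ} (hab : IsCoprime a b)
    (h0 : a * b * (a + b) ≠ 0) {W' : WeierstrassCurve ℚ} [W'.IsElliptic]
    (ψ : Isogeny (freyCurve a b) W') (hψ : ψ.IsCyclic) : ¬ 5 ∣ ψ.degree := by
  haveI := isElliptic_freyCurve h0
  exact not_dvd_degree_of_hasIrreducibleModPGaloisRep ψ hψ Nat.prime_five (h5 a b hab h0)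

/-! ## 3. F13 (NEW, PROVED): Klein–Fricke `2 × 13` on a two-torsion-normal-form curve -/

/-- **F13 (generic).** A curve `y² = x³ + Ax² + Bx` over `ℚ` (two-torsion normal form, elliptic)
has no cyclic `ℚ`-isogeny of degree divisible by `13`, granted the Klein–Fricke-13 identity:
Klein–Fricke at `2` on the explicit `2`-isogeny `twoIsogeny` (`j = (s+16)³/s`), Klein–Fricke at `13`
on the cyclic degree-`13` quotient, and the landed `fibreProduct_twentySix_empty` (D₂₆).  NO cyclic
`26`-isogeny is constructed. -/
theorem thirteen_not_dvd_degree_of_isTwoTorsionNF (h13 : kleinFrickeThirteen_exists_j_eq)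
    (W : WeierstrassCurve ℚ) [W.IsTwoTorsionNF] [W.IsElliptic] {W' : WeierstrassCurve ℚ}
    [W'.IsElliptic] (ψ : Isogeny W W') (hψ : ψ.IsCyclic) : ¬ 13 ∣ ψ.degree := by
  intro h
  -- the explicit `2`-isogeny is cyclic (prime degree; inlined `isCyclic_of_degree_prime`)
  have hcyc2 : (W.twoIsogeny).IsCyclic :=
    haveI : Fact (W.twoIsogeny).degree.Prime := ⟨by rw [degree_twoIsogeny]; exact Nat.prime_two⟩
    isAddCyclic_of_prime_card (α := (W.twoIsogeny).toAddMonoidHom.ker) (p := (W.twoIsogeny).degree) rfl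
  obtain ⟨s, hs0, hjs⟩ := (W.twoIsogeny).exists_j_eq_klein_two_of_two_dvd_degree
    hcyc2 (by rw [degree_twoIsogeny])
  obtain ⟨V, hV, χ, -, hχd, -⟩ := ψ.exists_isCyclic_degree_eq_of_dvd hψ (d := 13) h
  haveI := hV
  obtain ⟨t, ht0, hjt⟩ := h13 χ hχd
  have hjs' : W.j * s = (s + 16) ^ 3 := by
    rw [hjs]; field_simp
  have hjt' : W.j * t = (t ^ 2 + 5 * t + 13) * (t ^ 4 + 7 * t ^ 3 + 20 * t ^ 2 + 19 * t + 1) ^ 3 := by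
    rw [hjt]; field_simp
  exact fibreProduct_twentySix_empty s t hs0 ht0 (by linear_combination s * hjt' - t * hjs')

/-- **F13 (Frey).** `13 ∤ deg ψ` for every cyclic `ℚ`-isogeny out of `E_(a,b) : y² = x(x−a)(x+b)`
(two-torsion normal form `⟨0, b−a, 0, −ab, 0⟩`, `isTwoTorsionNF_freyCurve`). Replaces k2-g2 F4 and
k3-g2 H5/H7 + level 26. -/
theorem thirteen_not_dvd_degree_freyCurve (h13 : kleinFrickeThirteen_exists_j_eq) {a b : ℤ}
    (h0 : a * b * (a + b) ≠ 0) {W' : WeierstrassCurve ℚ} [W'.IsElliptic]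
    (ψ : Isogeny (freyCurve a b) W') (hψ : ψ.IsCyclic) : ¬ 13 ∣ ψ.degree := by
  haveI := isElliptic_freyCurve h0
  haveI := isTwoTorsionNF_freyCurve a b
  exact thirteen_not_dvd_degree_of_isTwoTorsionNF h13 (freyCurve a b) ψ hψ

/-! ## 4. H1 (k3-g2, PROVED there; re-proved verbatim since the k3 module is not importable):
prime support at an odd multiplicative place from Mazur Cor. 4.4 alone -/

/-- (k3-g2 H1a) The `p`-part of a cyclic kernel is a `Γ_ℚ`-stable subgroup of `E[p]` of order `p`. -/
theorem exists_stable_natCard_eq_of_isCyclic_dvd {W W'' : WeierstrassCurve ℚ} [W.IsElliptic]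
    [W''.IsElliptic] (φ : Isogeny W W'') (hφ : φ.IsCyclic) {p : ℕ} (_hp : p.Prime)
    (hpd : p ∣ φ.degree) :
    ∃ C : AddSubgroup (geomTorsion W (p : ℤ)),
      (∀ σ : Field.absoluteGaloisGroup ℚ, ∀ P ∈ C, σ • P ∈ C) ∧ Nat.card C = p := by
  set H := φ.toAddMonoidHom.ker ⊓ geomTorsion W (p : ℤ) with hH
  refine ⟨H.addSubgroupOf (geomTorsion W (p : ℤ)), ?_, ?_⟩
  · intro σ P hP
    rw [AddSubgroup.mem_addSubgroupOf] at hP ⊢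
    exact φ.smul_mem_ker_inf_geomTorsion (p : ℤ) σ hP
  · rw [Nat.card_congr (AddSubgroup.addSubgroupOfEquivOfLe
      (inf_le_right : H ≤ geomTorsion W (p : ℤ))).toEquiv]
    exact φ.natCard_ker_inf_geomTorsion_of_isCyclic hφ hpd

/-- (k3-g2 H1b) An odd multiplicative place of `ℤ` gives a place of `𝓞 ℚ` off `2` with `v(j) > 1`. -/
theorem exists_oddPlace_one_lt_valuation_j {W : WeierstrassCurve ℚ} [W.IsElliptic]
    {v : HeightOneSpectrum ℤ} (hv2 : Rat.HeightOneSpectrum.natGenerator v ≠ 2)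
    (hv : W.HasMultiplicativeReductionAt v) :
    ∃ v' : HeightOneSpectrum (𝓞 ℚ), (2 : 𝓞 ℚ) ∉ v'.asIdeal ∧ 1 < v'.valuation ℚ W.j := by
  set v' : HeightOneSpectrum (𝓞 ℚ) :=
    (Rat.HeightOneSpectrum.primesEquiv (R := 𝓞 ℚ)).symm
      (Rat.HeightOneSpectrum.primesEquiv v) with hv'def
  have hvv' : (Rat.HeightOneSpectrum.primesEquiv v : Nat.Primes) =
      Rat.HeightOneSpectrum.primesEquiv v' := by
    rw [hv'def, Equiv.apply_symm_apply]
  have h1 : W.conductorExponent v = 1 := (conductorExponent_eq_one_iff_holds v W).mpr hv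
  rw [conductorExponent_eq_of_primesEquiv_eq v v' W hvv'] at h1
  have hW : W.HasMultiplicativeReductionAt v' := (conductorExponent_eq_one_iff_holds v' W).mp h1
  refine ⟨v', Mazur1978.two_not_mem_asIdeal_of_ne_two v' ?_,
    one_lt_valuation_j_of_hasMultiplicativeReduction_localMinimalModel v' W hW⟩
  rw [← hvv']
  exact hv2

/-- (k3-g2 H1) **Prime support at an odd multiplicative place, from Cor. 4.4 alone**: a prime dividing
the degree of a cyclic `ℚ`-isogeny out of a curve multiplicative at an odd place is in `{2,3,5,7,13}`. -/
theorem mem_oddSupport_of_cor44 (h44 : Mazur1978.cor44_valuation_j_le_one)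
    {W W'' : WeierstrassCurve ℚ} [W.IsElliptic] [W''.IsElliptic] (φ : Isogeny W W'')
    (hφ : φ.IsCyclic) {v : HeightOneSpectrum ℤ} (hv2 : Rat.HeightOneSpectrum.natGenerator v ≠ 2)
    (hv : W.HasMultiplicativeReductionAt v) {p : ℕ} (hp : p.Prime) (hpd : p ∣ φ.degree) :
    p ∈ ({2, 3, 5, 7, 13} : Finset ℕ) := by
  by_contra hnot
  haveI : Fact p.Prime := ⟨hp⟩
  obtain ⟨v', hv'2, hv'j⟩ := exists_oddPlace_one_lt_valuation_j hv2 hv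
  exact absurd (h44 W p (Mazur1978.eq_eleven_or_seventeen_le_of_not_mem hp hnot)
    (exists_stable_natCard_eq_of_isCyclic_dvd φ hφ hp hpd) v' hv'2) (not_le.mpr hv'j)

/-! ## 5. SUPP (PROVED): the Frey prime support `{2, 3, 7}` — H1 + F5 + F13, nothing else -/

/-- **SUPP.** For a Frey curve with an odd multiplicative place, every prime dividing the degree of a
cyclic `ℚ`-isogeny out of it is `2`, `3` or `7`. -/
theorem frey_primeSupport (h44 : Mazur1978.cor44_valuation_j_le_one)
    (h13 : kleinFrickeThirteen_exists_j_eq) (h5 : FreyFiveIrreducible) {a b : ℤ}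
    (hab : IsCoprime a b) (h0 : a * b * (a + b) ≠ 0)
    {v : HeightOneSpectrum ℤ} (hv2 : Rat.HeightOneSpectrum.natGenerator v ≠ 2)
    (hv : (freyCurve a b).HasMultiplicativeReductionAt v) :
    haveI := isElliptic_freyCurve h0
    ∀ (W'' : WeierstrassCurve ℚ) [W''.IsElliptic] (φ : Isogeny (freyCurve a b) W''), φ.IsCyclic →
      ∀ p : ℕ, p.Prime → p ∣ φ.degree → p ∈ ({2, 3, 7} : Finset ℕ) := by
  haveI := isElliptic_freyCurve h0
  intro W'' _ φ hφ p hp hpd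
  have hmem := mem_oddSupport_of_cor44 h44 φ hφ hv2 hv hp hpd
  have hne5 : p ≠ 5 := by
    rintro rfl
    exact five_not_dvd_degree_freyCurve h5 hab h0 φ hφ hpd
  have hne13 : p ≠ 13 := by
    rintro rfl
    exact thirteen_not_dvd_degree_freyCurve h13 h0 φ hφ hpd
  simp only [Finset.mem_insert, Finset.mem_singleton] at hmem ⊢
  omega

/-! ## 6. Exclusions `{21, 27, 32, 49}` out of a Frey curve -/

/-- `j(E_(a,b)) = 2⁸ (a² + ab + b²)³ / (ab(a+b))² ≥ 0` (k2-g2, PROVED; re-proved, 4 lines). -/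
theorem j_freyCurve_nonneg {a b : ℤ} [(freyCurve a b).IsElliptic] (h0 : a * b * (a + b) ≠ 0) :
    0 ≤ (freyCurve a b).j := by
  rw [j_freyCurve h0]
  have hx : 0 ≤ (a : ℚ) ^ 2 + a * b + b ^ 2 := by
    nlinarith [sq_nonneg ((a : ℚ) + b), sq_nonneg (a : ℚ), sq_nonneg (b : ℚ)]
  exact div_nonneg (mul_nonneg (by norm_num) (pow_nonneg hx 3)) (sq_nonneg _)

/-- **E27** (k2-g2, PROVED): no cyclic sub-degree `27` out of a Frey curve (`j = −2¹⁵·3·5³ < 0`). -/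
theorem not_twentySeven_dvd_degree_of_freyCurve {a b : ℤ} (h0 : a * b * (a + b) ≠ 0)
    {W' : WeierstrassCurve ℚ} [W'.IsElliptic] (ψ : Isogeny (freyCurve a b) W')
    (hψ : ψ.IsCyclic) : ¬ 27 ∣ ψ.degree := by
  haveI := isElliptic_freyCurve h0
  intro h27
  obtain ⟨W'', hW'', χ, hχcyc, hχdeg, -⟩ := ψ.exists_isCyclic_degree_eq_of_dvd hψ h27
  haveI := hW''
  have hj := χ.j_eq_of_isCyclic_degree_twentySeven hχcyc hχdeg
  have hnn := j_freyCurve_nonneg (a := a) (b := b) h0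
  rw [hj] at hnn
  norm_num at hnn

/-- **P (NEW, PROVED): `j(E_(a,b)) ≠ 3375/2`** — the one X₀(21)-point with `j > 0`.  Clearing
denominators in `j = 2⁸(a²+ab+b²)³/(ab(a+b))²` gives `2⁹ (a²+ab+b²)³ = 3375 (ab(a+b))²` in `ℤ` with
`a² + ab + b²` odd (`a, b` coprime): `2`-adic valuations `9 ≠ 2·v₂(ab(a+b))`. -/
theorem j_freyCurve_ne_twentyOneRow {a b : ℤ} (hab : IsCoprime a b) (h0 : a * b * (a + b) ≠ 0)
    [(freyCurve a b).IsElliptic] : (freyCurve a b).j ≠ 3375 / 2 := by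
  rw [j_freyCurve h0]
  have hD : ((a : ℚ) * b * (a + b)) ≠ 0 := by exact_mod_cast h0
  intro h
  rw [div_eq_div_iff (pow_ne_zero 2 hD) two_ne_zero] at h
  have hZ : (2 : ℤ) ^ 9 * (a ^ 2 + a * b + b ^ 2) ^ 3 = 3375 * (a * b * (a + b)) ^ 2 := by
    have hQ : (2 : ℚ) ^ 9 * ((a : ℚ) ^ 2 + a * b + b ^ 2) ^ 3 = 3375 * ((a : ℚ) * b * (a + b)) ^ 2 := by
      linear_combination h
    exact_mod_cast hQ
  -- `a² + ab + b²` is odd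
  have h2unit : ¬ IsUnit (2 : ℤ) := by
    rw [Int.isUnit_iff]; omega
  have hX : Odd (a ^ 2 + a * b + b ^ 2) := by
    rcases Int.even_or_odd a with ⟨k, hk⟩ | ⟨k, hk⟩ <;>
      rcases Int.even_or_odd b with ⟨l, hl⟩ | ⟨l, hl⟩
    · exact absurd (hab.isUnit_of_dvd' ⟨k, by rw [hk]; ring⟩ ⟨l, by rw [hl]; ring⟩) h2unit
    · exact ⟨2 * k ^ 2 + 2 * k * l + k + 2 * l ^ 2 + 2 * l, by rw [hk, hl]; ring⟩
    · exact ⟨2 * k ^ 2 + 2 * k + 2 * k * l + l + 2 * l ^ 2, by rw [hk, hl]; ring⟩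
    · exact ⟨2 * k ^ 2 + 3 * k + 2 * k * l + 3 * l + 2 * l ^ 2 + 1, by rw [hk, hl]; ring⟩
  -- pass to `ℕ` and compare `2`-adic valuations
  set x : ℕ := (a ^ 2 + a * b + b ^ 2).natAbs with hx
  set d : ℕ := (a * b * (a + b)).natAbs with hd
  have hxodd : Odd x := Int.natAbs_odd.mpr hX
  have hx2 : ¬ 2 ∣ x := hxodd.not_two_dvd_nat
  have hx0 : x ≠ 0 := fun h => hx2 (h ▸ dvd_zero 2)
  have hd0 : d ≠ 0 := Int.natAbs_ne_zero.mpr h0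
  have hN : 2 ^ 9 * x ^ 3 = 3375 * d ^ 2 := by
    have h' := congrArg Int.natAbs hZ
    rw [Int.natAbs_mul, Int.natAbs_pow, Int.natAbs_mul, Int.natAbs_pow, Int.natAbs_pow] at h'
    exact h'
  have e1 : padicValNat 2 (2 ^ 9 * x ^ 3) = 9 := by
    rw [padicValNat.mul (by norm_num) (pow_ne_zero 3 hx0), padicValNat.prime_pow,
      padicValNat.pow x 3, padicValNat.eq_zero_of_not_dvd hx2]
  have e2 : padicValNat 2 (3375 * d ^ 2) = 2 * padicValNat 2 d := by
    rw [padicValNat.mul (by norm_num) (pow_ne_zero 2 hd0), padicValNat.pow d 2,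
      padicValNat.eq_zero_of_not_dvd (by norm_num : ¬ 2 ∣ 3375)]
    ring
  rw [hN, e2] at e1
  omega

/-- **E21 (NEW, PROVED).**  No cyclic `ℚ`-isogeny of degree `21` out of a Frey curve: the landed
X₀(21) table (`levelTwentyOne_jTable_of` + Klein–Fricke 7, as in `kenkuCompositeTables_proof`) puts
`j` among `−140625/8, 3375/2, −1159088625/2²¹, −189613868625/2⁷`; three are `< 0 ≤ j(Frey)`, the
fourth is excluded by `j_freyCurve_ne_twentyOneRow`.  (k3-g2 H4a's valuation route also works.) -/
theorem frey_degree_ne_twentyOne {a b : ℤ} (hab : IsCoprime a b) (h0 : a * b * (a + b) ≠ 0)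
    {W' : WeierstrassCurve ℚ} [W'.IsElliptic] (ψ : Isogeny (freyCurve a b) W')
    (hψ : ψ.IsCyclic) : ψ.degree ≠ 21 := by
  haveI := isElliptic_freyCurve h0
  intro h21
  have hT : (21, (freyCurve a b).j) ∈ kenkuIsogenyJTable :=
    levelTwentyOne_jTable_of (fun W W' _ φ h7 ↦ φ.exists_j_eq_klein_seven_of_degree_eq_seven h7
      (φ.j_ne_zero_of_degree_eq_seven_rat h7)) _ W' ψ hψ h21
  have hrows : ∀ r ∈ kenkuIsogenyJTable, r.1 = 21 →
      r.2 = -140625 / 8 ∨ r.2 = 3375 / 2 ∨ r.2 = -1159088625 / 2097152 ∨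
        r.2 = -189613868625 / 128 := by
    decide +kernel
  have hnn := j_freyCurve_nonneg (a := a) (b := b) h0
  have hj4 := hrows _ hT rfl
  simp only at hj4
  rcases hj4 with hj | hj | hj | hj
  · rw [hj] at hnn; norm_num at hnn
  · exact j_freyCurve_ne_twentyOneRow hab h0 hj
  · rw [hj] at hnn; norm_num at hnn
  · rw [hj] at hnn; norm_num at hnn

/-- **EXCL.** The Frey barrier: no cyclic degree in `{21, 27, 32, 49}` out of `E_(a,b)`
(E21 stub; E27; landed levels 32, 49). -/
theorem frey_barrier_excl {a b : ℤ} (hab : IsCoprime a b) (h0 : a * b * (a + b) ≠ 0) :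
    haveI := isElliptic_freyCurve h0
    ∀ (W'' : WeierstrassCurve ℚ) [W''.IsElliptic] (φ : Isogeny (freyCurve a b) W''), φ.IsCyclic →
      φ.degree ∉ ({21, 27, 32, 49} : Finset ℕ) := by
  haveI := isElliptic_freyCurve h0
  intro W'' _ φ hφ hmem
  have hsplit : ∀ n ∈ ({21, 27, 32, 49} : Finset ℕ), n = 21 ∨ n = 27 ∨ n = 32 ∨ n = 49 := by decide
  rcases hsplit _ hmem with h | h | h | h
  · exact frey_degree_ne_twentyOne hab h0 φ hφ h
  · exact not_twentySeven_dvd_degree_of_freyCurve h0 φ hφ (h ▸ dvd_rfl)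
  · exact isogeny_isCyclic_degree_ne_thirtyTwo φ hφ h
  · exact isogeny_isCyclic_degree_ne_fortyNine φ hφ h

/-! ## 7. Radius `≤ 163` from support + covering barrier (k3-g2 H2/H3F, PROVED there; re-proved verbatim) -/

theorem exists_dvd_gt_le_sq' {n : ℕ} (hn : 163 < n)
    (hp : ∀ p : ℕ, p.Prime → p ∣ n → p ≤ 163) :
    ∃ d, d ∣ n ∧ 163 < d ∧ d ≤ 163 * 163 := by
  have hex : ∃ e, e ∣ n ∧ 163 < e := ⟨n, dvd_rfl, hn⟩
  refine ⟨Nat.find hex, (Nat.find_spec hex).1, (Nat.find_spec hex).2, ?_⟩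
  by_contra hgt
  rw [not_le] at hgt
  obtain ⟨hdn, hd⟩ := Nat.find_spec hex
  obtain ⟨p, hpp, hpd⟩ := Nat.exists_prime_and_dvd (show Nat.find hex ≠ 1 by omega)
  have hple : p ≤ 163 := hp p hpp (hpd.trans hdn)
  obtain ⟨m, hm⟩ := hpd
  have hmd : m ∣ Nat.find hex := Dvd.intro_left p hm.symm
  have hm163 : 163 < m := by
    by_contra hmle
    have := Nat.mul_le_mul hple (not_lt.mp hmle)
    omega
  have hmlt : m < Nat.find hex := by
    rw [hm]
    exact lt_mul_of_one_lt_left (by omega) hpp.one_lt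
  exact Nat.find_min hex hmlt ⟨hmd.trans hdn, hm163⟩

/-- (k3-g2 H2) Pointwise radius, generic in the support `S` and the barrier `B`. -/
theorem radius_at_of_support_of_barrier (S B : Finset ℕ) (hS : ∀ p ∈ S, p ≤ 163)
    (hcov : ∀ d ∈ Finset.Ioc 163 (163 * 163), (∀ p ∈ d.primeFactors, p ∈ S) → ∃ b ∈ B, b ∣ d)
    {W : WeierstrassCurve ℚ} [W.IsElliptic]
    (hsupp : ∀ (W'' : WeierstrassCurve ℚ) [W''.IsElliptic] (φ : Isogeny W W''), φ.IsCyclic →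
      ∀ p : ℕ, p.Prime → p ∣ φ.degree → p ∈ S)
    (hexcl : ∀ (W'' : WeierstrassCurve ℚ) [W''.IsElliptic] (φ : Isogeny W W''), φ.IsCyclic →
      φ.degree ∉ B)
    {W' : WeierstrassCurve ℚ} [W'.IsElliptic] (hiso : W.IsIsogenous W') :
    ∃ φ : Isogeny W W', φ.degree ≤ 163 := by
  obtain ⟨ψ, hψ⟩ := hiso.exists_isCyclic
  refine ⟨ψ, ?_⟩
  by_contra hlt
  rw [not_le] at hlt
  have hprime : ∀ p : ℕ, p.Prime → p ∣ ψ.degree → p ∈ S := fun p hp hpd ↦ hsupp W' ψ hψ p hp hpd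
  obtain ⟨d₁, hd₁n, hlt₁, hle₁⟩ :=
    exists_dvd_gt_le_sq' hlt fun p hp hpd ↦ hS p (hprime p hp hpd)
  have hd₁S : ∀ p ∈ d₁.primeFactors, p ∈ S := fun p hp ↦ by
    obtain ⟨hpp, hpd, -⟩ := Nat.mem_primeFactors.mp hp
    exact hprime p hpp (hpd.trans hd₁n)
  obtain ⟨b, hbB, hbd⟩ := hcov d₁ (Finset.mem_Ioc.mpr ⟨hlt₁, hle₁⟩) hd₁S
  obtain ⟨W'', hW'', χ, hχ, hχd, -⟩ := ψ.exists_isCyclic_degree_eq_of_dvd hψ (hbd.trans hd₁n)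
  haveI := hW''
  exact hexcl W'' χ hχ (hχd ▸ hbB)

/-- (k3-g2 H3F core) every `d ∈ (163, 163²]` dividing `42¹⁵` has a divisor in `{21,27,32,49}`. -/
theorem freyBarrier_covers_core :
    ∀ d ∈ Finset.Ioc 163 (163 * 163), 2232232135326160725639168 % d = 0 →
      ∃ b ∈ ({21, 27, 32, 49} : Finset ℕ), b ∣ d := by
  decide +kernel

theorem frey_pow_fifteen_dvd : ∀ p ∈ ({2, 3, 7} : Finset ℕ), p ^ 15 ∣ 2232232135326160725639168 := by
  decide +kernel

/-- (k3-g2) From the core check to the prime-factor form. -/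
theorem covers_of_core (S B : Finset ℕ) (M : ℕ) (hM : ∀ p ∈ S, p ^ 15 ∣ M)
    (hcore : ∀ d ∈ Finset.Ioc 163 (163 * 163), M % d = 0 → ∃ b ∈ B, b ∣ d) :
    ∀ d ∈ Finset.Ioc 163 (163 * 163), (∀ p ∈ d.primeFactors, p ∈ S) → ∃ b ∈ B, b ∣ d := by
  intro d hd hS
  refine hcore d hd (Nat.mod_eq_zero_of_dvd ?_)
  obtain ⟨hd163, hd26569⟩ := Finset.mem_Ioc.mp hd
  refine (Nat.dvd_iff_prime_pow_dvd_dvd _ _).mpr fun p k hp hpk => ?_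
  rcases Nat.eq_zero_or_pos k with rfl | hk
  · exact (pow_zero p).symm ▸ one_dvd _
  have hpd : p ∣ d := (dvd_pow_self p hk.ne').trans hpk
  have hp_mem : p ∈ S := hS p (Nat.mem_primeFactors.mpr ⟨hp, hpd, by omega⟩)
  have hk15 : k ≤ 15 := by
    have h1 : p ^ k ≤ d := Nat.le_of_dvd (by omega) hpk
    have h2 : 2 ^ k ≤ p ^ k := Nat.pow_le_pow_left hp.two_le k
    by_contra hk15
    have h3 : 2 ^ 16 ≤ 2 ^ k := Nat.pow_le_pow_right (by norm_num) (by omega)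
    norm_num at h3
    omega
  exact (pow_dvd_pow p hk15).trans (hM p hp_mem)

/-- (k3-g2 H3F) The Frey barrier `{21, 27, 32, 49}` covers every `{2,3,7}`-smooth `d ∈ (163, 163²]`. -/
theorem freyBarrier_covers :
    ∀ d ∈ Finset.Ioc 163 (163 * 163), (∀ p ∈ d.primeFactors, p ∈ ({2, 3, 7} : Finset ℕ)) →
      ∃ b ∈ ({21, 27, 32, 49} : Finset ℕ), b ∣ d :=
  covers_of_core _ _ _ frey_pow_fifteen_dvd freyBarrier_covers_core

/-! ## 8. Assemblies (PROVED modulo E21): radius 163, `FreyIsogenyRadius 163`, `Lemma68FreyOdd`,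
and the skeleton's `hval` with the SAME constant `163` as `stub_valTransport` -/

/-- **TOP (radius at an odd multiplicative place).** -/
theorem freyRadius163 (h44 : Mazur1978.cor44_valuation_j_le_one)
    (h13 : kleinFrickeThirteen_exists_j_eq) (h5 : FreyFiveIrreducible) {a b : ℤ}
    (hab : IsCoprime a b) (h0 : a * b * (a + b) ≠ 0)
    {v : HeightOneSpectrum ℤ} (hv2 : Rat.HeightOneSpectrum.natGenerator v ≠ 2)
    (hv : (freyCurve a b).HasMultiplicativeReductionAt v) :
    haveI := isElliptic_freyCurve h0
    ∀ (W' : WeierstrassCurve ℚ) [W'.IsElliptic], (freyCurve a b).IsIsogenous W' →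
      ∃ φ : Isogeny (freyCurve a b) W', φ.degree ≤ 163 := by
  haveI := isElliptic_freyCurve h0
  intro W' _ hiso
  exact radius_at_of_support_of_barrier ({2, 3, 7} : Finset ℕ) ({21, 27, 32, 49} : Finset ℕ)
    (by decide) freyBarrier_covers (frey_primeSupport h44 h13 h5 hab h0 hv2 hv)
    (frey_barrier_excl hab h0) hiso

/-- The odd multiplicative place of `ℤ` above an odd conductor prime `q` of a Frey curve. -/
theorem exists_oddMultPlace_freyCurve {a b : ℤ} (hab : IsCoprime a b) (h0 : a * b * (a + b) ≠ 0)
    {q : ℕ} (hq : q.Prime) (hq2 : q ≠ 2) (hqN : q ∣ (freyCurve a b).conductorNorm ℤ) :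
    ∃ v : HeightOneSpectrum ℤ, Rat.HeightOneSpectrum.natGenerator v = q ∧
      Rat.HeightOneSpectrum.natGenerator v ≠ 2 ∧ (freyCurve a b).HasMultiplicativeReductionAt v := by
  haveI := isElliptic_freyCurve h0
  obtain ⟨v, hv⟩ :
      ∃ v : HeightOneSpectrum ℤ, Rat.HeightOneSpectrum.natGenerator v = q :=
    ⟨(Rat.HeightOneSpectrum.primesEquiv (R := ℤ)).symm ⟨q, hq⟩,
      Rat.natGenerator_primesEquiv_symm ⟨q, hq⟩⟩
  have hdvd : (q : ℤ) ∣ a * b * (a + b) := dvd_of_dvd_conductorNorm_freyCurve hab h0 hq hq2 hqN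
  exact ⟨v, hv, hv ▸ hq2,
    hasMultiplicativeReductionAt_freyCurve_of_ne_two hab h0 v (hv ▸ hq2) (hv ▸ hdvd)⟩

/-- **`FreyIsogenyRadius 163`** (k2-g2's target with the LITERAL constant, not 1008). -/
theorem freyIsogenyRadius163 (h44 : Mazur1978.cor44_valuation_j_le_one)
    (h13 : kleinFrickeThirteen_exists_j_eq) (h5 : FreyFiveIrreducible) : FreyIsogenyRadius 163 := by
  intro a b hab h0 q hq hq2 hqN W' _ hiso
  obtain ⟨v, -, hv2, hmult⟩ := exists_oddMultPlace_freyCurve hab h0 hq hq2 hqN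
  exact freyRadius163 h44 h13 h5 hab h0 hv2 hmult W' hiso

/-- Lemma 6.8 at one triple from ONE isogeny of degree `≤ R` (k3-g2 H0 with `163 ↦ R`, PROVED). -/
theorem lemma68At_of_degree_le {R : ℕ} {W W' : WeierstrassCurve ℚ} [W.IsElliptic] [W'.IsElliptic]
    (φ : Isogeny W W') (hφ : φ.degree ≤ R) (v : HeightOneSpectrum ℤ)
    (hv : W.HasMultiplicativeReductionAt v) :
    ∃ m n : ℕ, 0 < m ∧ m ≤ R ∧ 0 < n ∧ n ≤ R ∧
      W.ordMinimalDiscriminant v * n = W'.ordMinimalDiscriminant v * m := by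
  have hv' : W'.HasMultiplicativeReductionAt v := hasMultiplicativeReductionAt_of_isIsogenous ⟨φ⟩ v hv
  obtain ⟨ψ, hψ, hdvd⟩ := φ.exists_isCyclic_degree_dvd
  obtain ⟨a, b, ha, hb, hab, h⟩ :=
    exists_ordMinimalDiscriminant_mul_eq_mul_of_isCyclic ψ.degree ψ hψ rfl v hv hv'
  have hψle : ψ.degree ≤ R := (Nat.le_of_dvd φ.degree_pos hdvd).trans hφ
  have hab' : a * b ≤ R := (Nat.le_of_dvd ψ.degree_pos hab).trans hψle
  refine ⟨a, b, ha, ?_, hb, ?_, h⟩ <;> nlinarith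

/-- **`Lemma68FreyOdd`** (k3-g2's re-cut leaf, constant 163) from `h44`, `h13`, `h5` (mod E21). -/
theorem lemma68FreyOdd_of (h44 : Mazur1978.cor44_valuation_j_le_one)
    (h13 : kleinFrickeThirteen_exists_j_eq) (h5 : FreyFiveIrreducible) : Lemma68FreyOdd := by
  intro a b hab h0 W' _ hiso v hv2 hv
  haveI := isElliptic_freyCurve h0
  obtain ⟨φ, hφ⟩ := freyRadius163 h44 h13 h5 hab h0 hv2 hv W' hiso
  exact lemma68At_of_degree_le φ hφ v hv

/-- **The skeleton's `hval` — literally the conclusion of the landed `stub_valTransport` (p96813), with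
the SAME constant `163`, but from `h44 + h13 + h5` instead of `PastenShimura2024_lemma_6_8`.**  The
re-glue of `definiteRTControlPrime_of_facts` is the one-token change
`stub_valTransport h68 ↦ valTransport163 h44 h13 h5` (C = 4·163·163 unchanged). -/
theorem valTransport163 (h44 : Mazur1978.cor44_valuation_j_le_one)
    (h13 : kleinFrickeThirteen_exists_j_eq) (h5 : FreyFiveIrreducible) :
    ∀ (a b : ℤ), IsCoprime a b → a * b * (a + b) ≠ 0 → ∀ q : ℕ, q.Prime → q ≠ 2 →
      q ∣ (freyCurve a b).conductorNorm ℤ →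
      ∀ (W' : WeierstrassCurve ℚ) [W'.IsElliptic], (freyCurve a b).IsIsogenous W' →
        (W'.minimalDiscriminantNorm ℤ).factorization q ≤
          163 * ((freyCurve a b).minimalDiscriminantNorm ℤ).factorization q := by
  intro a b hab h0 q hq hq2 hqN W' _ hiso
  haveI := isElliptic_freyCurve h0
  obtain ⟨v, hv, hv2, hmult⟩ := exists_oddMultPlace_freyCurve hab h0 hq hq2 hqN
  obtain ⟨φ, hφ⟩ := freyRadius163 h44 h13 h5 hab h0 hv2 hmult W' hiso
  obtain ⟨m, n, hm0, -, -, hn, hmnEq⟩ := lemma68At_of_degree_le φ hφ v hmult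
  have h1 := factorization_minimalDiscriminantNorm_holds (freyCurve a b) v
  have h2 := factorization_minimalDiscriminantNorm_holds W' v
  rw [hv] at h1 h2
  rw [h1, h2]
  calc W'.ordMinimalDiscriminant v
      ≤ W'.ordMinimalDiscriminant v * m := Nat.le_mul_of_pos_right _ hm0
    _ = (freyCurve a b).ordMinimalDiscriminant v * n := hmnEq.symm
    _ ≤ (freyCurve a b).ordMinimalDiscriminant v * 163 := Nat.mul_le_mul_left _ hn
    _ = 163 * (freyCurve a b).ordMinimalDiscriminant v := Nat.mul_comm _ _

/-! ## 9. Free-constant fallback (no E21): support `{2,3,7}` + caps ⇒ `deg ∣ 1008` -/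

/-- **A (k2-g2's arithmetic stub, NOW PROVED).** Support `⊆ {2,3,7}` with `2⁵, 3³, 7² ∤ d` gives
`d ∣ 2⁴·3²·7 = 1008` (`Nat.dvd_iff_prime_pow_dvd_dvd`). -/
theorem dvd_1008 {d : ℕ} (hS : ∀ ℓ : ℕ, ℓ.Prime → ℓ ∣ d → ℓ = 2 ∨ ℓ = 3 ∨ ℓ = 7)
    (h32 : ¬ 32 ∣ d) (h27 : ¬ 27 ∣ d) (h49 : ¬ 49 ∣ d) : d ∣ 1008 := by
  refine (Nat.dvd_iff_prime_pow_dvd_dvd 1008 d).mpr fun p k hp hpk => ?_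
  rcases Nat.eq_zero_or_pos k with rfl | hk
  · exact (pow_zero p).symm ▸ one_dvd _
  have hpd : p ∣ d := (dvd_pow_self p hk.ne').trans hpk
  rcases hS p hp hpd with rfl | rfl | rfl
  · have hk4 : k ≤ 4 := by
      by_contra hk4
      exact h32 (by rw [show (32 : ℕ) = 2 ^ 5 by norm_num]; exact (pow_dvd_pow 2 (by omega)).trans hpk)
    exact (pow_dvd_pow 2 hk4).trans (by norm_num)
  · have hk2 : k ≤ 2 := by
      by_contra hk2
      exact h27 (by rw [show (27 : ℕ) = 3 ^ 3 by norm_num]; exact (pow_dvd_pow 3 (by omega)).trans hpk)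
    exact (pow_dvd_pow 3 hk2).trans (by norm_num)
  · have hk1 : k ≤ 1 := by
      by_contra hk1
      exact h49 (by rw [show (49 : ℕ) = 7 ^ 2 by norm_num]; exact (pow_dvd_pow 7 (by omega)).trans hpk)
    exact (pow_dvd_pow 7 hk1).trans (by norm_num)

/-- **`FreyIsogenyRadius 1008` without E21** (A now proved; no sorry): the glue `valTransport_of_freyIsogenyRadius`
of k2-g2 then gives `hval` with `163 ↦ 1008` (C = 4·163·1008; C is free in the crux). -/
theorem freyIsogenyRadius1008 (h44 : Mazur1978.cor44_valuation_j_le_one)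
    (h13 : kleinFrickeThirteen_exists_j_eq) (h5 : FreyFiveIrreducible) : FreyIsogenyRadius 1008 := by
  intro a b hab h0 q hq hq2 hqN W' _ hiso
  haveI := isElliptic_freyCurve h0
  obtain ⟨v, -, hv2, hmult⟩ := exists_oddMultPlace_freyCurve hab h0 hq hq2 hqN
  obtain ⟨ψ, hψ⟩ := hiso.exists_isCyclic
  refine ⟨ψ, Nat.le_of_dvd (by norm_num) (dvd_1008 ?_ ?_ ?_ ?_)⟩
  · intro ℓ hℓ hℓd
    have hm := frey_primeSupport h44 h13 h5 hab h0 hv2 hmult W' ψ hψ ℓ hℓ hℓd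
    simpa only [Finset.mem_insert, Finset.mem_singleton] using hm
  · intro h32
    obtain ⟨W'', hW'', χ, hχ, hχd, -⟩ := ψ.exists_isCyclic_degree_eq_of_dvd hψ h32
    haveI := hW''
    exact isogeny_isCyclic_degree_ne_thirtyTwo χ hχ hχd
  · exact not_twentySeven_dvd_degree_of_freyCurve h0 ψ hψ
  · intro h49
    obtain ⟨W'', hW'', χ, hχ, hχd, -⟩ := ψ.exists_isCyclic_degree_eq_of_dvd hψ h49
    haveI := hW''
    exact isogeny_isCyclic_degree_ne_fortyNine χ hχ hχd

end Summit.ABC.ABC.Cruxes.DefiniteRTControlPrime.StubIdeas2G3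


/-! ## 10. THE RE-GLUE, kernel-checked: the crux `DefiniteRTControlPrime` from Takahashi 2.3, Pasten's
`163`-fact, Mazur Cor. 4.4, Klein–Fricke 13 and the tree's Frey rigidity at 5 — NO Lemma 6.8, NO
Mazur Thm. 1.  (`definiteRTControlPrime_of_valTransport` = the landed composition
`definiteRTControlPrime_of_facts` (p97354, module not yet built on the farm, hence copied) with its ONE
use of `h68` — the line `hval` — turned into a hypothesis; `isIsogenous_of_f_eq'`,
`exists_conductorMinimal'` = its two proved helpers, verbatim.) -/

namespace Summit.ABC.ABC.Theorems.DefiniteRTControlPrime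

open Summit.ABC.ABC.Theses.DefiniteXi
open Literature.NumberTheory.EllipticCurves Literature.NumberTheory.EllipticCurves.ModularForms
open Literature.NumberTheory.Automorphic
open WeierstrassCurve

/-- (copy of the landed `isIsogenous_of_f_eq`, p97354) -/
theorem isIsogenous_of_f_eq' {W W' : WeierstrassCurve ℚ} [W.IsElliptic] [W'.IsElliptic] {N : ℕ}
    [NeZero N] (D : ModularParametrizationData W N) (D' : ModularParametrizationData W' N)
    (hf : D'.f = D.f) : W.IsIsogenous W' := by
  obtain ⟨W₀, hW₀, D₀, hf₀, h₀⟩ := D.exists_optimalDatum'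
  haveI := hW₀
  have key : ∀ {V : WeierstrassCurve ℚ} [V.IsElliptic] (P : ModularParametrizationData V N),
      P.f = D₀.f → W₀.IsIsogenous V := by
    intro V _ P hP
    have hc₀ : (D₀.c : ℚ) ≠ 0 := by exact_mod_cast D₀.maninConstant_ne_zero_holds
    have hc : (P.c : ℚ) ≠ 0 := by exact_mod_cast P.maninConstant_ne_zero_holds
    refine isIsogenous_of_forall_mul_mem_lattice D₀.isNeronLattice.1 D₀.isNeronLattice.2
      P.isNeronLattice.1 P.isNeronLattice.2 (c := (P.c : ℚ) / D₀.c) (div_ne_zero hc hc₀) ?_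
    intro z hz
    obtain ⟨w, hw, rfl⟩ := h₀ z hz
    have hw' : w ∈ periodLattice P.f := by rw [hP]; exact hw
    have : (((P.c : ℚ) / D₀.c : ℚ) : ℂ) * ((D₀.c : ℂ) * w) = (P.c : ℂ) * w := by
      have hc₀' : (D₀.c : ℂ) ≠ 0 := D₀.cast_c_ne_zero
      push_cast
      field_simp
    rw [this]
    exact P.smul_periodLattice_le w hw'
  have h1 : W₀.IsIsogenous W := key D hf₀.symm
  have h2 : W₀.IsIsogenous W' := key D' (hf.trans hf₀.symm)
  exact h1.symm_of_charZero.trans' h2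

/-- (copy of the landed `exists_conductorMinimal`, p97354) -/
theorem exists_conductorMinimal' {V : WeierstrassCurve ℚ} [V.IsElliptic] {N : ℕ} [NeZero N]
    (D₁ : ModularParametrizationData V N) (hV : V.conductorNorm ℤ = N) :
    ∃ (Ws : WeierstrassCurve ℚ) (_ : Ws.IsElliptic) (Ps : ModularParametrizationData Ws N),
      Ws.conductorNorm ℤ = N ∧ Ps.f = D₁.f ∧
      ∀ (W' : WeierstrassCurve ℚ) [W'.IsElliptic], W'.conductorNorm ℤ = N →
        ∀ P' : ModularParametrizationData W' N, P'.f = Ps.f →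
          Ps.modularDegree ≤ P'.modularDegree := by
  classical
  set S : Set ℕ := {d | ∃ (W' : WeierstrassCurve ℚ) (_ : W'.IsElliptic)
      (P' : ModularParametrizationData W' N),
      W'.conductorNorm ℤ = N ∧ P'.f = D₁.f ∧ P'.modularDegree = d} with hS_def
  have hS : S.Nonempty := ⟨D₁.modularDegree, V, ‹_›, D₁, hV, rfl, rfl⟩
  obtain ⟨Ws, hWs, Ps, hNs, hfs, hdeg⟩ := Nat.sInf_mem hS
  refine ⟨Ws, hWs, Ps, hNs, hfs, fun W' _ hW' P' hP' => ?_⟩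
  rw [hdeg]
  exact Nat.sInf_le ⟨W', ‹_›, P', hW', hP'.trans hfs, rfl⟩

/-- **The composition with `hval` as a hypothesis** (body = the landed
`definiteRTControlPrime_of_facts`, its single `stub_valTransport h68 …` line replaced by `hval …`). -/
theorem definiteRTControlPrime_of_valTransport (hT : takahashi2001_thm_2_3_of_coprime)
    (h163 : PastenShimura2024_minimalDegree_le_163_mul)
    (hval163 : ∀ (a b : ℤ), IsCoprime a b → a * b * (a + b) ≠ 0 → ∀ q : ℕ, q.Prime → q ≠ 2 →
      q ∣ (freyCurve a b).conductorNorm ℤ →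
      ∀ (W' : WeierstrassCurve ℚ) [W'.IsElliptic], (freyCurve a b).IsIsogenous W' →
        (W'.minimalDiscriminantNorm ℤ).factorization q ≤
          163 * ((freyCurve a b).minimalDiscriminantNorm ℤ).factorization q) :
    DefiniteRTControlPrime := by
  intro ε hε
  refine ⟨4 * 163 * 163, ?_⟩
  intro a b hab h0 N _ hN q hq hq2 hqN D hDmin
  obtain ⟨M, hM⟩ := hqN
  rw [mul_comm] at hM
  subst hM
  haveI := isElliptic_freyCurve h0
  have hdiv : M * q / q = M := Nat.mul_div_cancel M hq.pos
  rw [hdiv]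
  have hqN' : q ∣ (freyCurve a b).conductorNorm ℤ := by rw [hN]; exact Dvd.intro_left M rfl
  have hcop : M.Coprime q := by
    have h := stub_freyLocal a b hab h0 q hq hq2 hqN'
    rwa [hN, hdiv] at h
  obtain ⟨C, hC⟩ := hasGlobalMinimalModel_rat_holds (freyCurve a b)
  haveI := hC
  have hNm : (C • freyCurve a b).conductorNorm ℤ = M * q := by rw [conductorNorm_smul_rat, hN]
  have hne : Nonempty (ModularParametrizationData (C • freyCurve a b) (M * q)) :=
    (Summit.ABC.ABC.Theorems.nonempty_modularParametrizationData_smul_iff C).mpr ⟨D⟩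
  obtain ⟨D₁, -, hD₁min⟩ := exists_minimal_datum hne
  obtain ⟨W₀, hW₀, D₀, hf₀, h₀⟩ := D₁.exists_optimalDatum'
  haveI := hW₀
  have hker₀ : D₀.isogenyMap.ker = ⊥ := D₀.isogenyMap_ker_eq_bot_iff.mpr h₀
  have hmin₀ : ∀ (W' : WeierstrassCurve ℚ) [W'.IsElliptic]
      (D' : ModularParametrizationData W' (M * q)), D'.f = D₀.f →
        D₀.modularDegree ≤ D'.modularDegree := fun W' _ D' hD' =>
    D₀.modularDegree_le_of_isogenyMap_ker_eq_bot hker₀ D' hD'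
  have h163' : D₁.modularDegree ≤ 163 * D₀.modularDegree :=
    h163 (M * q) W₀ (C • freyCurve a b) D₀ D₁ hf₀.symm hmin₀ hD₁min
  obtain ⟨Ws, hWs, Ps, hNs, hfs, hPsmin⟩ := exists_conductorMinimal' D₁ hNm
  haveI := hWs
  have h0s : D₀.modularDegree ≤ Ps.modularDegree := hmin₀ Ws Ps (hfs.trans hf₀.symm)
  have hTak : Ps.modularDegree ≤ brandtXi M q (fun n => Ws.LFunction n) *
      (Ws.minimalDiscriminantNorm ℤ).factorization q :=
    takahashi2001_thm_2_3_of_coprime.modularDegree_le_brandtXi_mul hT Ws M q hq hcop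
      hNs Ps hPsmin
  have hL : (fun n => Ws.LFunction n) = fun n => (freyCurve a b).LFunction n := by
    funext n
    have h1 := Ps.isNewformOf.2 n
    have h2 := D₁.isNewformOf.2 n
    rw [hfs] at h1
    rw [h1, LFunction_smul] at h2
    exact_mod_cast h2
  rw [hL] at hTak
  have hiso : (freyCurve a b).IsIsogenous Ws :=
    (isIsogenous_smul (freyCurve a b) C).trans' (isIsogenous_of_f_eq' D₁ Ps hfs)
  -- (T_val): THE ONE CHANGED LINE — `hval163` instead of `stub_valTransport h68`
  have hval : (Ws.minimalDiscriminantNorm ℤ).factorization q ≤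
      163 * ((freyCurve a b).minimalDiscriminantNorm ℤ).factorization q :=
    hval163 a b hab h0 q hq hq2 hqN' Ws hiso
  obtain ⟨D₁', -, hdeg₁'⟩ := stub_smulTransportDeg C D₁
  have hscale : (C.u : ℚ).num.natAbs ≤ 2 := stub_freyScale a b hab h0 C hC
  have hD : D.deg ≤ 4 * D₁.modularDegree := by
    calc D.deg ≤ D₁'.deg := hDmin D₁'
      _ = (C.u : ℚ).num.natAbs ^ 2 * D₁.deg := hdeg₁'
      _ ≤ 2 ^ 2 * D₁.deg := Nat.mul_le_mul_right _ (Nat.pow_le_pow_left hscale 2)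
      _ = 4 * D₁.modularDegree := by norm_num [ModularParametrizationData.modularDegree]
  set ξ : ℕ := brandtXi M q (fun n => (freyCurve a b).LFunction n) with hξ
  set v : ℕ := ((freyCurve a b).minimalDiscriminantNorm ℤ).factorization q with hv
  have hchain : D.deg ≤ 4 * 163 * 163 * (ξ * v) :=
    calc D.deg ≤ 4 * D₁.modularDegree := hD
      _ ≤ 4 * (163 * D₀.modularDegree) := Nat.mul_le_mul_left _ h163'
      _ ≤ 4 * (163 * Ps.modularDegree) := Nat.mul_le_mul_left _ (Nat.mul_le_mul_left _ h0s)
      _ ≤ 4 * (163 * (ξ * (Ws.minimalDiscriminantNorm ℤ).factorization q)) :=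
          Nat.mul_le_mul_left _ (Nat.mul_le_mul_left _ hTak)
      _ ≤ 4 * (163 * (ξ * (163 * v))) :=
          Nat.mul_le_mul_left _ (Nat.mul_le_mul_left _ (Nat.mul_le_mul_left _ hval))
      _ = 4 * 163 * 163 * (ξ * v) := by ring
  have hN1 : (1 : ℝ) ≤ ((M * q : ℕ) : ℝ) := by
    exact_mod_cast Nat.one_le_iff_ne_zero.mpr (NeZero.ne (M * q))
  have hrpow : (1 : ℝ) ≤ ((M * q : ℕ) : ℝ) ^ ε := Real.one_le_rpow hN1 hε.le
  have hcast : (D.deg : ℝ) ≤ (4 * 163 * 163 : ℝ) * ((ξ : ℝ) * (v : ℝ)) := by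
    exact_mod_cast hchain
  have hξv : (0 : ℝ) ≤ (ξ : ℝ) * (v : ℝ) := by positivity
  calc (D.deg : ℝ) ≤ (4 * 163 * 163 : ℝ) * ((ξ : ℝ) * (v : ℝ)) := hcast
    _ = (4 * 163 * 163 : ℝ) * 1 * ((ξ : ℝ) * (v : ℝ)) := by ring
    _ ≤ (4 * 163 * 163 : ℝ) * ((M * q : ℕ) : ℝ) ^ ε * ((ξ : ℝ) * (v : ℝ)) := by gcongr

/-- **THE CRUX ON THE NEW TRUST BASE (kernel-checked, no sorry):** `DefiniteRTControlPrime` from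
Takahashi 2001 Thm. 2.3, Pasten's `163`-fact, **Mazur 1978 Cor. 4.4** (`h44`, item MazurCor44),
**Klein–Fricke level 13** (`h13`, cite-only) and the tree's Frey rigidity at `5` (`h5`, =
`hasIrreducibleModPGaloisRep_freyCurve_five`).  Pasten's Lemma 6.8 (`stub_pastenLemma68`,
Mazur-Thm-1-complete) is no longer an input.  [cite: Mazur1978, Cor. 4.4] [cite: Kenku1982, Thm. 1]
[cite: PastenShimura2024, Lemma 6.8 (p. 22)] -/
theorem definiteRTControlPrime_of_cor44_kleinFricke13 (hT : takahashi2001_thm_2_3_of_coprime)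
    (h163 : PastenShimura2024_minimalDegree_le_163_mul) (h44 : Mazur1978.cor44_valuation_j_le_one)
    (h13 : kleinFrickeThirteen_exists_j_eq)
    (h5 : Summit.ABC.ABC.Cruxes.DefiniteRTControlPrime.StubIdeas2G3.FreyFiveIrreducible) :
    DefiniteRTControlPrime :=
  definiteRTControlPrime_of_valTransport hT h163
    (Summit.ABC.ABC.Cruxes.DefiniteRTControlPrime.StubIdeas2G3.valTransport163 h44 h13 h5)

end Summit.ABC.ABC.Theorems.DefiniteRTControlPrime

end
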